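import Literature.MathematicalPhysics.QuantumFieldTheory.Balaban1983to89.B9Thm33G0ProbeZeroAtCutPins
import Literature.MathematicalPhysics.QuantumFieldTheory.Balaban1983to89.B9SmoothHolderClassPClosure

/-!
# `Balaban1983to89.B9HolderProbesKAFromGradSrc` — T. Bałaban, *Propagators for lattice gauge theories in a background field*, Commun. Math. Phys. **99** (1985) 389–434
# [Balaban1985BackgroundPropagators], (3.40) + (3.43) p. 397–398 read for ANY operator INTO the bond carrier out of ANY source class: the cut probe family
# `Φ^X_s ∘ T : b → 𝔠_P^{(s−1)}` of a DIMENSION-1 output from a sup member `T : b → 𝔠^{(−1)}` and gradient members `∇_{U,ν} ∘ T : b → 𝔠⁽⁰⁾` (the mean-value step of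
# p. 423 along def-Y's taxicab contour), and the landing of `T` INTO the graded print-weighted bond class `bHZKPG` — the producer `G₀∇\*_{U,μ} : bHX ε → 𝔖₁` of the
# row-20 leaf over the regular state

[4] = T. Bałaban, *Propagators and renormalization transformations for lattice gauge theories. II*, Commun. Math. Phys. **96** (1984) 223–250 [`Balaban1984PropagatorsII`].
statement-level skeleton of published theorems with citation tags; proofs where landed; nothing here is a claim about the Yang–Mills mass gap.

THE PRINT.  (3.39)–(3.41) p. 397 (the sup norm, the covariant Hölder quotient *"|x − x′|^{−α}|R(U(Γ_{x,x′}))A(x′) − A(x)| … Γ_{x,x′} a shortest contour"*, the block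
localisation); Thm 3.1 (3.42)₃ p. 397 *"|(G′(U)∇\*_Uλ)(x)| ≦ B₀Lʲη e^{−δ₀d(y,y′)}|λ|"*, (3.43)₂ p. 398 *"‖ζG′(U)∇\*_Uλ‖_β ≦ B₀(β)(Lʲη)^{1−β}e^{−δ₀d(y,y′)}|λ|"*, (3.44) p. 398
(the twice-differentiated words out of the Hölder input `‖λ‖_ε + |λ|`); Thm 3.3 p. 399 (the same for G₀); p. 423 (Thm 3.12: the Hölder member of a factor read off the sup
bounds of the factor and of its covariant gradient).

WHY THIS FILE (cell `pub-ymgap`, node N06, bundle F7 rows 20–21, seat dag-n06-l g27; programme P-U8S step S6-c, `U8S-PROGRAMME-MEMO.md` §6).  The row-20 leaf over the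
regular state (`B9Thm312WholeLeafCompletePairMBZS`) takes, in its state block `hstate1`, the producer `G₀∇\*_{U,μ} : bHX ε → 𝔖₁` INTO the (P1′) pin class
`𝔖₁ = bHZKPG (taxiB U) wX`.  dag-n06-l g24's `B9SmoothHolderClassPClosure.hasMaj_into_bHZKPG_of_probeFamily` lands ANY operator there from a `𝔠^{(−1)}` sup member and the
family of (3.43)₂-literal probe members `Φ^X_s∘T : b → 𝔠_P^{(s−1)}`; for `T = G₀` (dimension 2) dag-n06-w6 derived that family from the sup bounds of `G₀` and `∇_UG₀`
(`B9Thm33G0ProbeZeroAtPinsAdm` ∕ `…AtCutPins`, raw sup input).  For `G₀∇\*_{U,μ}` the gradient member is the (3.44)-type word `∇_{U,ν}G₀∇\*_{U,μ}` OUT OF THE HÖLDER INPUT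
CLASS `bHX ε` (the certificate's `Thm33G0Dir.h44m`), so the telescope must be run from an ARBITRARY source class.  THIS FILE is that free-source, dimension-1 twin:
* §1 (one bond function `F`, pointwise hypotheses at an anchor `y′` with a size `M`: `|F| ≤ C₀·len·e^{−δd(·,y′)}·M`, `|∇_{U,ν}F| ≤ C₁·e^{−δd(·,y′)}·M`) ★ `norm_cdB_slice_le_of_grad`
  (the gradient input along the contour moved to the anchor), ★★ `pairProbe_le_of_adm` (admissible pair probe `≤ c_b(d+1)·b_b·C₁e^{δC₀}·len^{1−β}·e^{−δd}·M`, the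
  taxicab telescope `B9Eq340TaxiTelescope`), ★ `pointProbe_le_of_sup`, ★ `transProbe_le_of_sup` (`len^{1−β}` from the sup bound; unitary-like transport);
* §2 ★★★ `hasMaj_probesKA_of_sup_grad` — for ANY source class `b` and ANY `T` into the bond carrier: `T : b → 𝔠^{(−1)}` (`C₀e^{−δd}`) and `∇_{U,ν}∘T : b → 𝔠⁽⁰⁾` (`C₁e^{−δd}`,
  every ν) give, for every `β ≤ 1`, `Φ^X_β ∘ T : b → 𝔠_P^{(β−1)}` at the CUT carrier `holderProbesKA` with the β-independent constant `C_X(C₁) + C₀ + c_b·b_b·C₀`;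
* §3 ★★★ `hasMaj_into_bHZKPG_of_sup_grad` — the same two members land `T` INTO `bHZKPG (taxiB U) w` (any graded weights `0 ≤ w ≤ 1`) with
  `L·(C₀ + C_X(C₁) + C₀ + c_b b_b C₀)·e^{δ(r_near+1)}·e^{−δd}` (§2 + g24), rate KEPT;
* §4 ★★★ `hasMaj_G0Dds_into_bHZKPG_of_pins` — the instance `T = G₀∇\*_{U,μ}`, `b = bHX ε` under the certificate's pins (`𝔬.blk = blkBK bI`, `Dd U = ∇_{U,·}` in coordinates):
  from the (3.42)₃-type sup word `Thm33G0DirR.e2d μ` (raw), the (3.44)-type gradient words `Thm33G0Dir.h44m (ν, μ) ε` (out of `bHX ε`) and the domination of the sharp sup class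
  by the input class (`Letters313IM.domX ∕ locX`): `HasMaj (bHX ε) (bHZKPG (taxiB U) w) (G₀∇\*_{U,μ}) (A_I·e^{−δ₀d})` — the field `G₀∇\*_{U,μ} : bHX ε → 𝔖₁` of the S-leaf's
  `hstate1`, `A_I = L·(B₀ + C_X(B_i ε) + B₀ + c_b b_b B₀)·e^{δ₀(r_near+1)}`, at the certificate's rate `δ₀` EXACTLY.
HONEST SCOPE.  Finite-dimensional bookkeeping over def-Y's readings and landed telescope lemmas; the sup ∕ gradient members are HYPOTHESES of printed species ((3.42)₃,
(3.44)); nothing of [B9]∕[4] is asserted; no pin, no certificate edit; constants ours and not optimised; COUNT-NEUTRAL; N06 NOT discharged; one finite torus at a time —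
nothing continuum, nothing about OS positivity or the mass gap.  Cell `pub-ymgap` (HUMAN RULING D-0062), Track A node N06 [B9], seat `pub-ymgap-dag-n06-l` (g27), 2026-08-29.
NEW file; nothing landed is modified.
-/

namespace Literature.MathematicalPhysics.QuantumFieldTheory.Balaban1983to89.B9HolderProbesKAFromGradSrc

open LatticeFieldCalculus (supDist)
open B9Eq39Adjoint (R covD)
open B9BackgroundsKLevelV1 (CfgV1 shiftsV1)
open B6GlobalChartV1 (PV blkV1 domT)
open B6Ineq2142KLevelV1 (β lvl)
open B6KLevelCensusIndexV1 (KIdx Adm kGeo len_eq)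
open B6Geom246MultiLevelTorus (geomT)
open B6Prop22KLevelTorusCensusEta (nKT)
open B6RandomWalk (BlockSupp HasMajorant)
open B6RandomWalkHom (HasMajorantHom hasMajorantHom_mono)
open B9Thm34Ext (toB6)
open B9GeoNormsKLevelV1 (geo9K)
open B9GeoLemma21KLevelV1 (geo9K_len_pos)
open B9Thm39ReadingCoords (coordBound39 basisBound39 abs_repr_le)
open B9CoReadingCoords (assembleK coordOpK XBK blkBK cdBₗ)
open B9CoReadingCoordsHolder (PK blkPK probeK probeK_inl probeK_inr_inl probeK_inr_inr wK w₀K wK_nonneg w₀K_nonneg holderProbesK)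
open B9CoReadingCoordsHolderAdm (wKA holderProbesKA ΦX_KA_inl_of_adm ΦX_KA_inl_of_not_adm ΦX_KA_inr_inl ΦX_KA_inr_inr)
open Node00 (FBondY IBondY CfgY BondParY cdB parBY parTaxiV toKT)
open B9Eq340StepLasso (rungSites taxiSteps)
open B9Eq340TaxiTelescope (holderWeight_mul_norm_sub_R_parTaxiV_le_of_rungs_of_le supDist_rungSites_taxiSteps_le norm_covD_slice_eq norm_R_le)
open B9Eq340NearPairBlocks (near_exp_carrier_le)
open B9Thm33G0ProbeZeroAtPinsAdm (norm_assembleK_le cdB_assembleK unitaryLike_parTaxiV w₀K_eq_len_rpow)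
open T4RelativeLadder (UnitaryLike)
open B9Thm312Whole (GeoOK Ops)
open B9Thm312WholeClasses (cNormR cNormR_loc hasMaj_cNormR_of_hasMajorantHom hasMaj_of_in_zero)
open B9SmoothHolderClassTClosure (abs_apply_le_of_hasMaj_cNormR)
open B9SmoothHolderClassP (bHZKPG)
open B9SmoothHolderClassPClosure (hasMaj_into_bHZKPG_of_probeFamily)
open B9GradViaDivLettersTransported (taxiB)
open B9MultiscaleSmoothPartitionYNear (rNear)
open B11SectG (BlockNorm HasMaj)

noncomputable section

variable {d ℓ : ℕ} {hd : 1 ≤ d + 1} {hL : Odd (ℓ + 1) ∧ 1 < ℓ + 1} {b₀ b₁ : ℝ}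
variable {𝔸 : Type} [NormedRing 𝔸] [NormedAlgebra ℂ 𝔸] [CompleteSpace 𝔸]
variable {κ : Type} [Fintype κ]

/-! ## §1 The probes of ONE bond function from pointwise sup and gradient bounds at an anchor -/

section Pointwise

variable (i : KIdx d ℓ hd hL b₀ b₁) (b : Module.Basis κ ℝ 𝔸) [FiniteDimensional ℝ 𝔸] [Fintype (geo9K i).Site]
variable {B : B9.Backgrounds} (cfg : B.Cfg → CfgY 𝔸 i) (U₁ : B.Cfg) {bI : FBondY i → IBondY i}

omit [FiniteDimensional ℝ 𝔸] [Fintype (geo9K i).Site] in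
/-- ★ **THE GRADIENT INPUT ALONG THE CONTOUR, MOVED TO THE ANCHOR** (free twin of dag-n06-w6's `norm_cdB_slice_G0_le`): if every coordinate of the direction-`μ` covariant
derivative of a bond function `F` obeys `|(∇_{U,μ}F)(q)| ≤ C₁·e^{−δ d(bI q, y′)}·M` (`C₁, M ≥ 0`), then at every bond `b′` within the admissible radius of `x` the slice
`Ψ = assembleK ν c′ F` has `‖(∇_{U,μ}Ψ)(b′)‖ ≤ b_b·C₁·e^{δ((d+1)(L+1)+2)}·e^{−δ d(bI x, y′)}·M` (pin `hβ1`; `b_b = Σ‖b_c‖`).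
[cite: Balaban1985BackgroundPropagators, (3.40) p.397 (x, x′ ∈ Δ̃(y)) + (3.44) p.398; Balaban1984PropagatorsII, (2.46) p.231, (2.51) p.232] -/
theorem norm_cdB_slice_le_of_grad (hβ1 : ∀ x : FBondY i, (geomT i.D).dist (β i.hN i.D i.hk (bI x)) (blkV1 i.hN i.D x) ≤ 1)
    (F : XBK κ i → ℝ) {C₁ δ M : ℝ} (hC₁ : 0 ≤ C₁) (hδ : 0 ≤ δ) (hM : 0 ≤ M) (μ : Fin (d + 1)) {y' : IBondY i}
    (hF1 : ∀ q : XBK κ i, |(coordOpK b (fun _ : Fin (d + 1) => cdBₗ i (cfg U₁) μ) F) q| ≤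
      C₁ * Real.exp (-(δ * (geo9K i).dist (bI q.1) y')) * M)
    {x b' : FBondY i} (hnear : supDist x.src b'.src ≤ (ℓ + 1) ^ (blkV1 i.hN i.D x).1.1) (ν : Fin (d + 1)) (c' : κ) :
    ‖cdB i (cfg U₁) μ (assembleK b ν c' F) b'‖ ≤
      basisBound39 b * (C₁ * Real.exp (δ * (((d : ℝ) + 1) * (((ℓ : ℝ) + 1) + 1) + 2)) * Real.exp (-(δ * (geo9K i).dist (bI x) y')) * M) := by
  rw [cdB_assembleK]
  refine norm_assembleK_le b ν c' _ b' fun a => ?_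
  have h1 := hF1 (b', ν, a, c')
  have hexp := near_exp_carrier_le i hβ1 hnear hδ y'
  have hE0 := Real.exp_nonneg (δ * (((d : ℝ) + 1) * (((ℓ : ℝ) + 1) + 1) + 2))
  have hE := Real.exp_nonneg (-(δ * (geo9K i).dist (bI x) y'))
  calc |(coordOpK b (fun _ : Fin (d + 1) => cdBₗ i (cfg U₁) μ) F) (b', ν, a, c')|
      ≤ C₁ * Real.exp (-(δ * (geo9K i).dist (bI b') y')) * M := h1
    _ ≤ C₁ * (Real.exp (δ * (((d : ℝ) + 1) * (((ℓ : ℝ) + 1) + 1) + 2)) * Real.exp (-(δ * (geo9K i).dist (bI x) y'))) * M := by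
        gcongr
        exact hexp
    _ = C₁ * Real.exp (δ * (((d : ℝ) + 1) * (((ℓ : ℝ) + 1) + 1) + 2)) * Real.exp (-(δ * (geo9K i).dist (bI x) y')) * M := by ring

omit [Fintype (geo9K i).Site] in
/-- ★★ **THE PAIR PROBE AT AN ADMISSIBLE PAIR FROM THE GRADIENT BOUND** (free twin of `pairProbe_G0_le_of_adm`): at def-Y's genuine transporter (`par = parBY i`), for
unitary-like bond variables and a bond function `F` whose every covariant derivative obeys `|(∇_{U,ν}F)(q)| ≤ C₁·e^{−δ d(bI q, y′)}·M`, an ADMISSIBLE pair `(x, x′)` and `β ≤ 1`: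
`|Φ^X_β(U)(F)(inl((x,x′),ν,c,c′))| ≤ c_b·(d+1)·len(bI x)^{1−β}·(b_b·C₁·e^{δ((d+1)(L+1)+2)}·e^{−δ d(bI x,y′)}·M)` — `(|x−x′|η)^{−β}·|x−x′|₁η·sup_Γ|∇_UΨ| ≤ (d+1)(Lʲη)^{1−β}·sup_Γ|∇_UΨ|`
along the taxicab contour, the sup along `Γ ⊂ Δ̃(y)` moved to the anchor. [cite: Balaban1985BackgroundPropagators, (3.40) p.397, (3.43)–(3.44) p.398, p.423] -/
theorem pairProbe_le_of_adm {par : BondParY 𝔸 i} (hpar : par = parBY i) (hU : ∀ μ s, UnitaryLike (cfg U₁ μ s))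
    (hlev : ∀ x : FBondY i, lvl i.hN i.D i.hk (bI x) = (blkV1 i.hN i.D x).1.1)
    (hβ1 : ∀ x : FBondY i, (geomT i.D).dist (β i.hN i.D i.hk (bI x)) (blkV1 i.hN i.D x) ≤ 1)
    (F : XBK κ i → ℝ) {C₁ δ M : ℝ} (hC₁ : 0 ≤ C₁) (hδ : 0 ≤ δ) (hM : 0 ≤ M) {y' : IBondY i}
    (hF1 : ∀ (μ : Fin (d + 1)) (q : XBK κ i), |(coordOpK b (fun _ : Fin (d + 1) => cdBₗ i (cfg U₁) μ) F) q| ≤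
      C₁ * Real.exp (-(δ * (geo9K i).dist (bI q.1) y')) * M)
    {x x' : FBondY i} (hadm : Adm i x x') {βh : ℝ} (hβh : βh ≤ 1) (ν : Fin (d + 1)) (c c' : κ) :
    |(holderProbesK i b B cfg par bI).ΦX U₁ βh F (Sum.inl ((x, x'), ν, c, c'))| ≤
      coordBound39 b * (((d : ℝ) + 1) * (geo9K i).len (bI x) ^ (1 - βh) *
        (basisBound39 b * (C₁ * Real.exp (δ * (((d : ℝ) + 1) * (((ℓ : ℝ) + 1) + 1) + 2)) *
          Real.exp (-(δ * (geo9K i).dist (bI x) y')) * M))) := by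
  subst hpar
  obtain ⟨hdir, hnear, -⟩ := hadm
  -- the slice read by the probe and the transported difference
  set Ψ : FBondY i → 𝔸 := assembleK b ν c' F with hΨ
  have hval : (holderProbesK i b B cfg (parBY i) bI).ΦX U₁ βh F (Sum.inl ((x, x'), ν, c, c')) =
      wK i βh x x' * b.repr (Ψ x - R (parBY i (cfg U₁) x.src x'.src) (Ψ x')) c := by
    rw [show (holderProbesK i b B cfg (parBY i) bI).ΦX U₁ βh =
        probeK b (fun x x' : FBondY i => parBY i (cfg U₁) x.src x'.src) (wK i βh) (w₀K i βh) from rfl, probeK_inl]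
  rw [hval, abs_mul, abs_of_nonneg (wK_nonneg i βh x x')]
  -- constants
  set D₀ : ℝ := basisBound39 b * (C₁ * Real.exp (δ * (((d : ℝ) + 1) * (((ℓ : ℝ) + 1) + 1) + 2)) *
      Real.exp (-(δ * (geo9K i).dist (bI x) y')) * M) with hD₀
  have hbB : 0 ≤ basisBound39 b := Finset.sum_nonneg fun _ _ => norm_nonneg _
  have hD₀0 : 0 ≤ D₀ := by rw [hD₀]; positivity
  have hη : 0 < |i.cf|⁻¹ := inv_pos.mpr (abs_pos.mpr i.hcf)
  -- the admissible radius in the reading's length: `|x − x′|_∞·|c_f|⁻¹ ≤ len(bI x)`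
  have hrad : (supDist x.src x'.src : ℝ) * |i.cf|⁻¹ ≤ (geo9K i).len (bI x) := by
    have e : (geo9K i).len (bI x) = (((ℓ + 1 : ℕ) : ℝ)) ^ (blkV1 i.hN i.D x).1.1 * |i.cf|⁻¹ := by
      rw [show (geo9K i).len (bI x) = (kGeo i).len (bI x) from rfl, len_eq, hlev x, div_eq_mul_inv]
    rw [e]
    exact mul_le_mul_of_nonneg_right (by exact_mod_cast hnear) hη.le
  -- the gradient input at every rung of the contour, through `norm_covD_slice_eq`
  have hrungs : ∀ r ∈ rungSites (taxiSteps (List.finRange (PV d ℓ i.m i.K hd hL).d) x.src x'.src) x.src,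
      ‖covD (shiftsV1 (PV d ℓ i.m i.K hd hL)) (cfg U₁) r.2.1 (fun s => Ψ ⟨s, x.dir⟩) r.1‖ ≤ |i.cf|⁻¹ * D₀ := by
    intro r hr
    have hv : supDist x.src r.1 ≤ (ℓ + 1) ^ (blkV1 i.hN i.D x).1.1 := ((supDist_rungSites_taxiSteps_le x.src x'.src r hr).1).trans hnear
    rw [norm_covD_slice_eq i (cfg U₁) r.2.1 Ψ ⟨r.1, x.dir⟩]
    refine mul_le_mul_of_nonneg_left ?_ hη.le
    rw [hΨ]
    exact norm_cdB_slice_le_of_grad i b cfg U₁ hβ1 F hC₁ hδ hM r.2.1 (hF1 r.2.1) (x := x) (b' := ⟨r.1, x.dir⟩) hv ν c'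
  -- the Hölder-weighted telescoping along def-Y's taxicab
  have key := holderWeight_mul_norm_sub_R_parTaxiV_le_of_rungs_of_le (P := PV d ℓ i.m i.K hd hL) hU (fun s => Ψ ⟨s, x.dir⟩) hη hD₀0 hβh
    x.src x'.src hrad hrungs
  -- reassemble: `x′ = ⟨x′.src, x.dir⟩`, `parBY = parTaxiV`, the weight is `wK`, `(PV …).d = d + 1`
  have hx' : (⟨x'.src, x.dir⟩ : FBondY i) = x' := by rw [hdir]
  have hPd : (((PV d ℓ i.m i.K hd hL).d : ℕ) : ℝ) = (d : ℝ) + 1 := by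
    rw [show (PV d ℓ i.m i.K hd hL).d = d + 1 from rfl, Nat.cast_succ]
  rw [hx', hPd] at key
  have hw : wK i βh x x' = ((supDist x.src x'.src : ℝ) * |i.cf|⁻¹) ^ (-βh) := rfl
  have hR : R (parBY i (cfg U₁) x.src x'.src) (Ψ x') = R (parTaxiV (cfg U₁) x.src x'.src) (Ψ x') := rfl
  calc wK i βh x x' * |b.repr (Ψ x - R (parBY i (cfg U₁) x.src x'.src) (Ψ x')) c|
      ≤ wK i βh x x' * (coordBound39 b * ‖Ψ x - R (parBY i (cfg U₁) x.src x'.src) (Ψ x')‖) :=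
        mul_le_mul_of_nonneg_left (abs_repr_le b _ c) (wK_nonneg i βh x x')
    _ = coordBound39 b * (((supDist x.src x'.src : ℝ) * |i.cf|⁻¹) ^ (-βh) * ‖Ψ x - R (parTaxiV (cfg U₁) x.src x'.src) (Ψ x')‖) := by
        rw [hw, hR]; ring
    _ ≤ coordBound39 b * (((d : ℝ) + 1) * (geo9K i).len (bI x) ^ (1 - βh) * D₀) :=
        mul_le_mul_of_nonneg_left key (by unfold coordBound39; exact norm_nonneg _)

omit [FiniteDimensional ℝ 𝔸] [Fintype (geo9K i).Site] in
/-- ★ **THE POINT PROBE FROM THE SUP BOUND** (free, dimension-1 twin of `pointProbe_G0_le`): `|w₀K β x · F(x,ν,c,c′)| ≤ C₀·len(bI x)^{1−β}·e^{−δ d(bI x,y′)}·M` from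
`|F(q)| ≤ C₀·len(bI q)·e^{−δ d(bI q,y′)}·M`. [cite: Balaban1985BackgroundPropagators, (3.39)–(3.41) p.397, (3.42) p.397] -/
theorem pointProbe_le_of_sup (par : BondParY 𝔸 i) (hlev : ∀ x : FBondY i, lvl i.hN i.D i.hk (bI x) = (blkV1 i.hN i.D x).1.1)
    (F : XBK κ i → ℝ) {C₀ δ M : ℝ} {y' : IBondY i}
    (hF0 : ∀ q : XBK κ i, |F q| ≤ C₀ * (geo9K i).len (bI q.1) * Real.exp (-(δ * (geo9K i).dist (bI q.1) y')) * M)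
    (βh : ℝ) (x : FBondY i) (ν : Fin (d + 1)) (c c' : κ) :
    |(holderProbesK i b B cfg par bI).ΦX U₁ βh F (Sum.inr (Sum.inr (x, ν, c, c')))| ≤
      C₀ * (geo9K i).len (bI x) ^ (1 - βh) * Real.exp (-(δ * (geo9K i).dist (bI x) y')) * M := by
  rw [show (holderProbesK i b B cfg par bI).ΦX U₁ βh = probeK b (fun x x' : FBondY i => par (cfg U₁) x.src x'.src) (wK i βh) (w₀K i βh) from rfl,
    probeK_inr_inr, abs_mul, abs_of_nonneg (w₀K_nonneg i βh x), w₀K_eq_len_rpow i hlev]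
  have h1 := hF0 (x, ν, c, c')
  have hlen0 : 0 < (geo9K i).len (bI x) := geo9K_len_pos i _
  have hw : 0 ≤ (geo9K i).len (bI x) ^ (-βh) := Real.rpow_nonneg hlen0.le _
  have e : (geo9K i).len (bI x) ^ (-βh) * (geo9K i).len (bI x) = (geo9K i).len (bI x) ^ (1 - βh) := by
    rw [show (1 : ℝ) - βh = -βh + 1 by ring, Real.rpow_add hlen0, Real.rpow_one]
  calc (geo9K i).len (bI x) ^ (-βh) * |F (x, ν, c, c')|
      ≤ (geo9K i).len (bI x) ^ (-βh) * (C₀ * (geo9K i).len (bI x) * Real.exp (-(δ * (geo9K i).dist (bI x) y')) * M) :=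
        mul_le_mul_of_nonneg_left h1 hw
    _ = C₀ * ((geo9K i).len (bI x) ^ (-βh) * (geo9K i).len (bI x)) * Real.exp (-(δ * (geo9K i).dist (bI x) y')) * M := by ring
    _ = C₀ * (geo9K i).len (bI x) ^ (1 - βh) * Real.exp (-(δ * (geo9K i).dist (bI x) y')) * M := by rw [e]

omit [Fintype (geo9K i).Site] in
/-- ★ **THE TRANSPORTED POINT PROBE FROM THE SUP BOUND** (free, dimension-1 twin of `transProbe_G0_le`; anchored at `bI x′`, ANY pair, unitary-like transport):
`|w₀K β x′ · repr_c(R(U(Γ_{x,x′}))Ψ(x′))| ≤ c_b·b_b·C₀·len(bI x′)^{1−β}·e^{−δ d(bI x′,y′)}·M`. [cite: Balaban1985BackgroundPropagators, (3.40) + (3.42) p.397] -/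
theorem transProbe_le_of_sup {par : BondParY 𝔸 i} (hpar : par = parBY i) (hU : ∀ μ s, UnitaryLike (cfg U₁ μ s))
    (hlev : ∀ x : FBondY i, lvl i.hN i.D i.hk (bI x) = (blkV1 i.hN i.D x).1.1)
    (F : XBK κ i → ℝ) {C₀ δ M : ℝ} {y' : IBondY i}
    (hF0 : ∀ q : XBK κ i, |F q| ≤ C₀ * (geo9K i).len (bI q.1) * Real.exp (-(δ * (geo9K i).dist (bI q.1) y')) * M)
    (βh : ℝ) (x x' : FBondY i) (ν : Fin (d + 1)) (c c' : κ) :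
    |(holderProbesK i b B cfg par bI).ΦX U₁ βh F (Sum.inr (Sum.inl ((x, x'), ν, c, c')))| ≤
      coordBound39 b * basisBound39 b * C₀ * (geo9K i).len (bI x') ^ (1 - βh) * Real.exp (-(δ * (geo9K i).dist (bI x') y')) * M := by
  subst hpar
  rw [show (holderProbesK i b B cfg (parBY i) bI).ΦX U₁ βh = probeK b (fun x x' : FBondY i => parBY i (cfg U₁) x.src x'.src) (wK i βh) (w₀K i βh) from rfl,
    probeK_inr_inl, abs_mul, abs_of_nonneg (w₀K_nonneg i βh x'), w₀K_eq_len_rpow i hlev]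
  set Ψ : FBondY i → 𝔸 := assembleK b ν c' F with hΨ
  have hlen0 : 0 < (geo9K i).len (bI x') := geo9K_len_pos i _
  have hw : 0 ≤ (geo9K i).len (bI x') ^ (-βh) := Real.rpow_nonneg hlen0.le _
  have hcB : 0 ≤ coordBound39 b := by unfold coordBound39; exact norm_nonneg _
  -- `‖R(U(Γ))Ψ(x′)‖ ≤ ‖Ψ(x′)‖ ≤ b_b·C₀·len(bI x′)·e^{−δd}·M`
  haveI : Nonempty (Fin (PV d ℓ i.m i.K hd hL).d) := ⟨⟨0, Nat.succ_pos d⟩⟩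
  have hu : UnitaryLike (parBY i (cfg U₁) x.src x'.src) := unitaryLike_parTaxiV hU x.src x'.src
  have hΨ' : ‖Ψ x'‖ ≤ basisBound39 b * (C₀ * (geo9K i).len (bI x') * Real.exp (-(δ * (geo9K i).dist (bI x') y')) * M) :=
    norm_assembleK_le b ν c' _ x' fun a => hF0 (x', ν, a, c')
  have e : (geo9K i).len (bI x') ^ (-βh) * (geo9K i).len (bI x') = (geo9K i).len (bI x') ^ (1 - βh) := by
    rw [show (1 : ℝ) - βh = -βh + 1 by ring, Real.rpow_add hlen0, Real.rpow_one]
  calc (geo9K i).len (bI x') ^ (-βh) * |b.repr (R (parBY i (cfg U₁) x.src x'.src) (Ψ x')) c|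
      ≤ (geo9K i).len (bI x') ^ (-βh) * (coordBound39 b * ‖R (parBY i (cfg U₁) x.src x'.src) (Ψ x')‖) :=
        mul_le_mul_of_nonneg_left (abs_repr_le b _ c) hw
    _ ≤ (geo9K i).len (bI x') ^ (-βh) * (coordBound39 b * ‖Ψ x'‖) :=
        mul_le_mul_of_nonneg_left (mul_le_mul_of_nonneg_left (norm_R_le hu _) hcB) hw
    _ ≤ (geo9K i).len (bI x') ^ (-βh) * (coordBound39 b *
          (basisBound39 b * (C₀ * (geo9K i).len (bI x') * Real.exp (-(δ * (geo9K i).dist (bI x') y')) * M))) :=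
        mul_le_mul_of_nonneg_left (mul_le_mul_of_nonneg_left hΨ' hcB) hw
    _ = coordBound39 b * basisBound39 b * C₀ * ((geo9K i).len (bI x') ^ (-βh) * (geo9K i).len (bI x')) *
          Real.exp (-(δ * (geo9K i).dist (bI x') y')) * M := by ring
    _ = coordBound39 b * basisBound39 b * C₀ * (geo9K i).len (bI x') ^ (1 - βh) * Real.exp (-(δ * (geo9K i).dist (bI x') y')) * M := by
        rw [e]

end Pointwise

/-! ## §2 ★★★ The cut probe family of ANY operator into the bond carrier out of ANY source class -/

section Package

variable (i : KIdx d ℓ hd hL b₀ b₁) (b : Module.Basis κ ℝ 𝔸) [FiniteDimensional ℝ 𝔸] [Fintype (geo9K i).Site]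
variable {B : B9.Backgrounds} (cfg : B.Cfg → CfgY 𝔸 i) (U₁ : B.Cfg) {bI : FBondY i → IBondY i}
variable {R₀ : ℝ} {H₀ : Prop} {F₁ : Type} [AddCommGroup F₁] [Module ℝ F₁]

/-- the sharp-block sup of `f` at `y` is below any `M ≥ 0` bounding `|f|` on the block. [folklore] -/
private theorem ofBlocks_loc_le_of_forall {X : Type} [Fintype X] (blk : X → IBondY i) {y : IBondY i} {f : X → ℝ} {M : ℝ} (hM : 0 ≤ M)
    (h : ∀ x, blk x = y → |f x| ≤ M) : (BlockNorm.ofBlocks (toB6 (geo9K i) R₀ H₀) blk).loc y f ≤ M := by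
  classical
  show (⨆ x : X, @ite ℝ (blk x = y) (Classical.propDecidable _) |f x| 0) ≤ M
  refine Real.iSup_le (fun x => ?_) hM
  split_ifs with hx
  · exact h x hx
  · exact hM

/-- ★★★ **THE CUT PROBE FAMILY OF ANY OPERATOR INTO THE BOND CARRIER, OUT OF ANY SOURCE CLASS.**  At def-Y's genuine transporter (`par = parBY i`), for unitary-like bond variables
and the pins `hlev ∕ hβ1`: if an ℝ-linear `T : F₁ → (XBK → ℝ)` has a `𝔠^{(−1)}` sup member `HasMaj b 𝔠^{(−1)}_{blkBK} T (C₀e^{−δd})` (`|Tf| ≤ Lʲη·C₀e^{−δd}·‖f‖_b`, (3.42)₃-type) and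
`𝔠⁽⁰⁾` gradient members `HasMaj b 𝔠⁽⁰⁾_{blkBK} (∇_{U,ν} ∘ T) (C₁e^{−δd})` for every direction `ν` ((3.44)-type), then for every `β ≤ 1`
`HasMaj b 𝔠_P^{(β−1)}_{blkPK} (Φ^X_β(U) ∘ T) ((C_X + C₀ + c_b·b_b·C₀)·e^{−δd})` at the CUT carrier `holderProbesKA`, `C_X = c_b·(d+1)·b_b·C₁·e^{δ((d+1)(L+1)+2)}`: pair probes at
admissible pairs by §1's telescope, `0` off `Adm`, transported-point ∕ point probes by the sup member — print's (3.43)₂ shape `B₀(β)(Lʲη)^{1−β}` with a β-INDEPENDENT constant.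
[cite: Balaban1985BackgroundPropagators, (3.40) p.397 + (3.42)–(3.44) pp.397–398 + p.423; Balaban1984PropagatorsII, (2.51)–(2.54) pp.232–233] -/
theorem hasMaj_probesKA_of_sup_grad (hG : GeoOK (geo9K i)) {par : BondParY 𝔸 i} (hpar : par = parBY i) (hU : ∀ μ s, UnitaryLike (cfg U₁ μ s))
    (hlev : ∀ x : FBondY i, lvl i.hN i.D i.hk (bI x) = (blkV1 i.hN i.D x).1.1)
    (hβ1 : ∀ x : FBondY i, (geomT i.D).dist (β i.hN i.D i.hk (bI x)) (blkV1 i.hN i.D x) ≤ 1)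
    {bS : BlockNorm (toB6 (geo9K i) R₀ H₀) F₁} {T : F₁ →ₗ[ℝ] (XBK κ i → ℝ)} {C₀ C₁ δ : ℝ} (hC₀ : 0 ≤ C₀) (hC₁ : 0 ≤ C₁) (hδ : 0 ≤ δ)
    (hsup : HasMaj bS (cNormR R₀ H₀ (blkBK i bI) hG.lenle (-1)) T (fun a a' => C₀ * Real.exp (-(δ * (geo9K i).dist a a'))))
    (hgrad : ∀ ν : Fin (d + 1), HasMaj bS (cNormR R₀ H₀ (blkBK i bI) hG.lenle 0)
      (coordOpK b (fun _ : Fin (d + 1) => cdBₗ i (cfg U₁) ν) ∘ₗ T) (fun a a' => C₁ * Real.exp (-(δ * (geo9K i).dist a a'))))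
    {βh : ℝ} (hβh : βh ≤ 1) :
    HasMaj bS (cNormR R₀ H₀ (blkPK bI) hG.lenle (βh - 1)) ((holderProbesKA i b B cfg par bI).ΦX U₁ βh ∘ₗ T)
      (fun a a' => (coordBound39 b * ((d : ℝ) + 1) * basisBound39 b * C₁ * Real.exp (δ * (((d : ℝ) + 1) * (((ℓ : ℝ) + 1) + 1) + 2)) +
        C₀ + coordBound39 b * basisBound39 b * C₀) * Real.exp (-(δ * (geo9K i).dist a a'))) := by
  classical
  set CX : ℝ := coordBound39 b * ((d : ℝ) + 1) * basisBound39 b * C₁ * Real.exp (δ * (((d : ℝ) + 1) * (((ℓ : ℝ) + 1) + 1) + 2)) with hCX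
  set CT : ℝ := coordBound39 b * basisBound39 b * C₀ with hCT
  have hcB : 0 ≤ coordBound39 b := by unfold coordBound39; exact norm_nonneg _
  have hbB : 0 ≤ basisBound39 b := Finset.sum_nonneg fun _ _ => norm_nonneg _
  have hCX0 : 0 ≤ CX := by rw [hCX]; positivity
  have hCT0 : 0 ≤ CT := by rw [hCT]; positivity
  set Ctot : ℝ := CX + C₀ + CT with hCtot
  have hCtot0 : 0 ≤ Ctot := by rw [hCtot]; linarith
  intro y' μ hμ y
  set M : ℝ := bS.loc y' μ with hMdef
  have hM : 0 ≤ M := bS.loc_nonneg _ _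
  -- the pointwise inputs of §1, read off the two members
  have hF0 : ∀ q : XBK κ i, |T μ q| ≤ C₀ * (geo9K i).len (bI q.1) * Real.exp (-(δ * (geo9K i).dist (bI q.1) y')) * M := by
    intro q
    have hv := abs_apply_le_of_hasMaj_cNormR i hG.lenle hsup hμ q
    have hl : 0 < (geo9K i).len (bI q.1) := geo9K_len_pos i _
    rw [show blkBK i bI q = bI q.1 from rfl, Real.rpow_neg hl.le, inv_inv, Real.rpow_one] at hv
    refine hv.trans (le_of_eq ?_)
    ring
  have hF1 : ∀ (ν : Fin (d + 1)) (q : XBK κ i), |(coordOpK b (fun _ : Fin (d + 1) => cdBₗ i (cfg U₁) ν) (T μ)) q| ≤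
      C₁ * Real.exp (-(δ * (geo9K i).dist (bI q.1) y')) * M := by
    intro ν q
    have hv := abs_apply_le_of_hasMaj_cNormR i hG.lenle (hgrad ν) hμ q
    rw [show blkBK i bI q = bI q.1 from rfl, Real.rpow_zero, inv_one, one_mul] at hv
    exact hv
  -- every probe anchored at `y` is `≤ Ctot·len(y)^{1−β}·e^{−δ d(y,y′)}·M`
  have hpt : ∀ idx : PK (FBondY i) (Fin (d + 1)) κ, blkPK bI idx = y →
      |(holderProbesKA i b B cfg par bI).ΦX U₁ βh (T μ) idx| ≤
        Ctot * (geo9K i).len y ^ (1 - βh) * Real.exp (-(δ * (geo9K i).dist y y')) * M := by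
    intro idx hidx
    have hup : ∀ {C a : ℝ} (z : IBondY i), C ≤ Ctot →
        a ≤ C * (geo9K i).len z ^ (1 - βh) * Real.exp (-(δ * (geo9K i).dist z y')) * M →
        a ≤ Ctot * (geo9K i).len z ^ (1 - βh) * Real.exp (-(δ * (geo9K i).dist z y')) * M := by
      intro C a z hCle h
      refine h.trans ?_
      have hl : 0 ≤ (geo9K i).len z ^ (1 - βh) := Real.rpow_nonneg (le_of_lt (geo9K_len_pos i z)) _
      have hE := Real.exp_nonneg (-(δ * (geo9K i).dist z y'))
      exact mul_le_mul_of_nonneg_right (mul_le_mul_of_nonneg_right (mul_le_mul_of_nonneg_right hCle hl) hE) hM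
    rcases idx with ⟨⟨x, x'⟩, ν, c, c'⟩ | ⟨⟨x, x'⟩, ν, c, c'⟩ | ⟨x, ν, c, c'⟩
    · have hx : bI x = y := hidx
      subst hx
      by_cases hadm : Adm i x x'
      · rw [ΦX_KA_inl_of_adm i b B cfg par U₁ βh (T μ) hadm ν c c']
        have h := pairProbe_le_of_adm i b cfg U₁ hpar hU hlev hβ1 (T μ) hC₁ hδ hM hF1 hadm hβh ν c c'
        exact hup (C := CX) (bI x) (by rw [hCtot]; linarith) (h.trans (le_of_eq (by rw [hCX]; ring)))
      · rw [ΦX_KA_inl_of_not_adm i b B cfg par U₁ βh (T μ) hadm ν c c', abs_zero]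
        have hl : 0 ≤ (geo9K i).len (bI x) ^ (1 - βh) := Real.rpow_nonneg (le_of_lt (geo9K_len_pos i (bI x))) _
        have hE := Real.exp_nonneg (-(δ * (geo9K i).dist (bI x) y'))
        positivity
    · have hx : bI x' = y := hidx
      subst hx
      rw [ΦX_KA_inr_inl]
      have h := transProbe_le_of_sup i b cfg U₁ hpar hU hlev (T μ) hF0 βh x x' ν c c'
      exact hup (C := CT) (bI x') (by rw [hCtot]; linarith) (h.trans (le_of_eq (by rw [hCT])))
    · have hx : bI x = y := hidx
      subst hx
      rw [ΦX_KA_inr_inr]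
      exact hup (C := C₀) (bI x) (by rw [hCtot]; linarith) (pointProbe_le_of_sup i b cfg U₁ par hlev (T μ) hF0 βh x ν c c')
  -- assemble the `𝔠_P^{(β−1)}` size at `y`
  have hlen0 : 0 < (geo9K i).len y := geo9K_len_pos i y
  have hl : 0 ≤ (geo9K i).len y ^ (1 - βh) := Real.rpow_nonneg hlen0.le _
  have hE := Real.exp_nonneg (-(δ * (geo9K i).dist y y'))
  have hloc : (BlockNorm.ofBlocks (toB6 (geo9K i) R₀ H₀) (blkPK bI)).loc y (((holderProbesKA i b B cfg par bI).ΦX U₁ βh ∘ₗ T) μ) ≤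
      Ctot * (geo9K i).len y ^ (1 - βh) * Real.exp (-(δ * (geo9K i).dist y y')) * M :=
    ofBlocks_loc_le_of_forall i (blkPK bI) (by positivity) hpt
  show (cNormR R₀ H₀ (blkPK bI) hG.lenle (βh - 1)).loc y (((holderProbesKA i b B cfg par bI).ΦX U₁ βh ∘ₗ T) μ) ≤
    Ctot * Real.exp (-(δ * (geo9K i).dist y y')) * M
  rw [cNormR_loc]
  calc (geo9K i).len y ^ (βh - 1) *
        (BlockNorm.ofBlocks (toB6 (geo9K i) R₀ H₀) (blkPK bI)).loc y (((holderProbesKA i b B cfg par bI).ΦX U₁ βh ∘ₗ T) μ)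
      ≤ (geo9K i).len y ^ (βh - 1) * (Ctot * (geo9K i).len y ^ (1 - βh) * Real.exp (-(δ * (geo9K i).dist y y')) * M) :=
        mul_le_mul_of_nonneg_left hloc (Real.rpow_nonneg hlen0.le _)
    _ = Ctot * ((geo9K i).len y ^ (βh - 1) * (geo9K i).len y ^ (1 - βh)) * Real.exp (-(δ * (geo9K i).dist y y')) * M := by ring
    _ = Ctot * Real.exp (-(δ * (geo9K i).dist y y')) * M := by
        rw [← Real.rpow_add hlen0, show βh - 1 + (1 - βh) = 0 by ring, Real.rpow_zero, mul_one]

/-! ## §3 ★★★ INTO the graded print-weighted bond class from a sup member and gradient members -/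

/-- ★★★ **INTO `bHZKPG (taxiB U) w` FROM A `𝔠^{(−1)}` SUP MEMBER AND `𝔠⁽⁰⁾` GRADIENT MEMBERS, RATE KEPT.**  For ANY source class `b`, ANY graded weights `0 ≤ w ≤ 1` and ANY
`T` into the bond carrier with the two members of §2 (`C₀e^{−δd}`, `C₁e^{−δd}`): `HasMaj b (bHZKPG (taxiB U) w) T (L·(C₀ + C_X + C₀ + c_b b_b C₀)·e^{δ(r_near+1)}·e^{−δd})` — §2's
probe family along the class's own table (`holderProbesKA … (parBY i)` reads `probeK b (taxiB U) (wKA s) (w₀K s)`, dag-n06-l g24 `ΦX_holderProbesKA_parBY`) fed to g24's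
`hasMaj_into_bHZKPG_of_probeFamily` with `w s·C_b ≤ C_b`.  The (P1′) producer landing for dimension-1 words whose Hölder member print reads off (3.42)₃ + (3.44).
[cite: Balaban1985BackgroundPropagators, Thm 3.1 (3.42)–(3.44) pp.397–398 + Thm 3.12 (3.138) p.423; Balaban1984PropagatorsII, (2.51)–(2.54) pp.232–233] -/
theorem hasMaj_into_bHZKPG_of_sup_grad [DecidableEq κ] (hG : GeoOK (geo9K i)) (hU : ∀ μ s, UnitaryLike (cfg U₁ μ s))
    (hlev : ∀ x : FBondY i, lvl i.hN i.D i.hk (bI x) = (blkV1 i.hN i.D x).1.1)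
    (hβ1 : ∀ x : FBondY i, (geomT i.D).dist (β i.hN i.D i.hk (bI x)) (blkV1 i.hN i.D x) ≤ 1)
    (hbI0 : ∀ f : FBondY i, bI f = bI ⟨f.src, 0⟩) (hcf : |i.cf| = (nKT (toKT i) : ℝ))
    (w : ℝ → ℝ) (hw0 : ∀ s, 0 ≤ w s) (hw1 : ∀ s, w s ≤ 1)
    {bS : BlockNorm (toB6 (geo9K i) R₀ H₀) F₁} {T : F₁ →ₗ[ℝ] (XBK κ i → ℝ)} {C₀ C₁ δ : ℝ} (hC₀ : 0 ≤ C₀) (hC₁ : 0 ≤ C₁) (hδ : 0 ≤ δ)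
    (hsup : HasMaj bS (cNormR R₀ H₀ (blkBK i bI) hG.lenle (-1)) T (fun a a' => C₀ * Real.exp (-(δ * (geo9K i).dist a a'))))
    (hgrad : ∀ ν : Fin (d + 1), HasMaj bS (cNormR R₀ H₀ (blkBK i bI) hG.lenle 0)
      (coordOpK b (fun _ : Fin (d + 1) => cdBₗ i (cfg U₁) ν) ∘ₗ T) (fun a a' => C₁ * Real.exp (-(δ * (geo9K i).dist a a')))) :
    HasMaj bS (bHZKPG (κ := κ) i b (taxiB i B cfg U₁) (R := R₀) (H := H₀) w hw0 hw1) T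
      (fun y y' => ((ℓ + 1 : ℕ) : ℝ) * (C₀ + (coordBound39 b * ((d : ℝ) + 1) * basisBound39 b * C₁ * Real.exp (δ * (((d : ℝ) + 1) * (((ℓ : ℝ) + 1) + 1) + 2)) +
          C₀ + coordBound39 b * basisBound39 b * C₀)) * Real.exp (δ * (rNear d ℓ + 1)) * Real.exp (-(δ * (geo9K i).dist y y'))) := by
  have hcB : 0 ≤ coordBound39 b := by unfold coordBound39; exact norm_nonneg _
  have hbB : 0 ≤ basisBound39 b := Finset.sum_nonneg fun _ _ => norm_nonneg _
  have hCtot : 0 ≤ coordBound39 b * ((d : ℝ) + 1) * basisBound39 b * C₁ * Real.exp (δ * (((d : ℝ) + 1) * (((ℓ : ℝ) + 1) + 1) + 2)) +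
      C₀ + coordBound39 b * basisBound39 b * C₀ := by positivity
  have hpr : ∀ s : ℝ, 0 < s → s < 1 → HasMaj bS (cNormR R₀ H₀ (blkPK bI) hG.lenle (s - 1)) (probeK b (taxiB i B cfg U₁) (wKA i s) (w₀K i s) ∘ₗ T)
      (fun a a' => (coordBound39 b * ((d : ℝ) + 1) * basisBound39 b * C₁ * Real.exp (δ * (((d : ℝ) + 1) * (((ℓ : ℝ) + 1) + 1) + 2)) +
        C₀ + coordBound39 b * basisBound39 b * C₀) * Real.exp (-(δ * (geo9K i).dist a a'))) :=
    fun s _ hs1 => hasMaj_probesKA_of_sup_grad i b cfg U₁ hG (par := parBY i) rfl hU hlev hβ1 hC₀ hC₁ hδ hsup hgrad hs1.le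
  exact hasMaj_into_bHZKPG_of_probeFamily i b (taxiB i B cfg U₁) hG.lenle w hw0 hw1 hβ1 hlev hbI0 hδ hcf hC₀ hCtot (fun s _ _ => hCtot)
    (fun s _ _ => mul_le_of_le_one_left hCtot (hw1 s)) hsup hpr

/-! ## §4 ★★★ The producer `G₀∇\*_{U,μ} : bHX ε → 𝔖₁` of the row-20 leaf over the regular state, under the certificate's pins -/

/-- ★★★ **`G₀∇\*_{U,μ}` OUT OF THE HÖLDER INPUT CLASS INTO THE (P1′) PIN CLASS, AT THE CERTIFICATE'S RATE.**  Under the pins `𝔬.blk = blkBK bI` and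
`Dd U = (ν ↦ ∇_{U,ν} in coordinates)` (the certificate's `hblk12 ∕ h𝔡Ad` shapes), def-Y's transporter, unitary-like bond variables: from the (3.42)₃-type sup word
`HasMajorantHom blk blk (G₀∘∇\*_{U,μ}) (B₀·len·e^{−δ₀d})` (`Thm33G0DirR.e2d μ`), the (3.44)-type gradient words `HasMaj (bHX ε) (ofBlocks blk) (∇_{U,ν}∘G₀∘∇\*_{U,μ}) (B_i·e^{−δ₀d})`
(`Thm33G0Dir.h44m (ν, μ) ε`, every ν) and the domination of the sharp sup class by the input class (`Letters313IM.domX ∕ locX` at ε):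
`HasMaj (bHX ε) (bHZKPG (taxiB U) w) (G₀∘∇\*_{U,μ}) (L·(B₀ + C_X(B_i) + B₀ + c_b b_b B₀)·e^{δ₀(r_near+1)}·e^{−δ₀d})` — the field `G₀∇\*_{U,μ} : bHX ε → 𝔖₁` of
`thm312Printed_completePairMBZS`'s `hstate1` at `𝔖₁ = bHZKPG (taxiB U) wX`, rate `δ₀` kept.
[cite: Balaban1985BackgroundPropagators, Thm 3.3 p.399 + (3.42)–(3.44) pp.397–398 + Thm 3.12 (3.138) p.423; Balaban1984PropagatorsII, (2.51)–(2.54) pp.232–233] -/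
theorem hasMaj_G0Dds_into_bHZKPG_of_pins [DecidableEq κ] (hG : GeoOK (geo9K i)) (hU : ∀ μ s, UnitaryLike (cfg U₁ μ s))
    (hlev : ∀ x : FBondY i, lvl i.hN i.D i.hk (bI x) = (blkV1 i.hN i.D x).1.1)
    (hβ1 : ∀ x : FBondY i, (geomT i.D).dist (β i.hN i.D i.hk (bI x)) (blkV1 i.hN i.D x) ≤ 1)
    (hbI0 : ∀ f : FBondY i, bI f = bI ⟨f.src, 0⟩) (hcf : |i.cf| = (nKT (toKT i) : ℝ))
    (w : ℝ → ℝ) (hw0 : ∀ s, 0 ≤ w s) (hw1 : ∀ s, w s ≤ 1)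
    {Y Z W : Type} [Fintype Y] [Fintype Z] [Fintype W] (𝔬 : Ops (geo9K i) B (XBK κ i) Y Z W) (hblk : 𝔬.blk = blkBK i bI)
    {Dd Dds : B.Cfg → Fin (d + 1) → Module.End ℝ (XBK κ i → ℝ)} (hDd : Dd U₁ = fun ν => coordOpK b (fun _ : Fin (d + 1) => cdBₗ i (cfg U₁) ν))
    {bHX : ℝ → BlockNorm (toB6 (geo9K i) R₀ H₀) (XBK κ i → ℝ)} {ε : ℝ}
    (hdomX : ∀ (y : (geo9K i).Site) (v : XBK κ i → ℝ), (BlockNorm.ofBlocks (toB6 (geo9K i) R₀ H₀) 𝔬.blk).loc y v ≤ (bHX ε).loc y v)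
    (hlocX : ∀ (y : (geo9K i).Site) (v : XBK κ i → ℝ), (bHX ε).IsLoc y v → (BlockNorm.ofBlocks (toB6 (geo9K i) R₀ H₀) 𝔬.blk).IsLoc y v)
    {B₀ Bi δ₀ : ℝ} (hB₀ : 0 ≤ B₀) (hBi : 0 ≤ Bi) (hδ₀ : 0 ≤ δ₀) (μ : Fin (d + 1))
    (he2d : HasMajorantHom (g := toB6 (geo9K i) R₀ H₀) 𝔬.blk 𝔬.blk (𝔬.G0 U₁ ∘ₗ Dds U₁ μ)
      (fun (a a' : (geo9K i).Site) => B₀ * (geo9K i).len a * Real.exp (-(δ₀ * (geo9K i).dist a a'))))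
    (h44 : ∀ ν : Fin (d + 1), HasMaj (bHX ε) (BlockNorm.ofBlocks (toB6 (geo9K i) R₀ H₀) 𝔬.blk) (Dd U₁ ν ∘ₗ (𝔬.G0 U₁ ∘ₗ Dds U₁ μ))
      (fun (a a' : (geo9K i).Site) => Bi * Real.exp (-(δ₀ * (geo9K i).dist a a')))) :
    HasMaj (bHX ε) (bHZKPG (κ := κ) i b (taxiB i B cfg U₁) (R := R₀) (H := H₀) w hw0 hw1) (𝔬.G0 U₁ ∘ₗ Dds U₁ μ)
      (fun y y' => ((ℓ + 1 : ℕ) : ℝ) * (B₀ + (coordBound39 b * ((d : ℝ) + 1) * basisBound39 b * Bi * Real.exp (δ₀ * (((d : ℝ) + 1) * (((ℓ : ℝ) + 1) + 1) + 2)) +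
          B₀ + coordBound39 b * basisBound39 b * B₀)) * Real.exp (δ₀ * (rNear d ℓ + 1)) * Real.exp (-(δ₀ * (geo9K i).dist y y'))) := by
  rw [hblk] at he2d h44 hdomX hlocX
  -- the sup word: 𝔠⁽⁰⁾ → 𝔠^{(−1)}, then out of the dominating input class
  have hG1 : HasMaj (cNormR R₀ H₀ (blkBK i bI) hG.lenle 0) (cNormR R₀ H₀ (blkBK i bI) hG.lenle (-1)) (𝔬.G0 U₁ ∘ₗ Dds U₁ μ)
      (fun a a' => B₀ * Real.exp (-(δ₀ * (geo9K i).dist a a'))) :=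
    hasMaj_cNormR_of_hasMajorantHom hG (C := fun a a' => B₀ * Real.exp (-(δ₀ * (geo9K i).dist a a')))
      (fun a a' => mul_nonneg hB₀ (Real.exp_nonneg _)) 1 0
      (hasMajorantHom_mono (g := toB6 (geo9K i) R₀ H₀) _ _ he2d fun a a' =>
        le_of_eq (by simp only [Real.rpow_zero, Real.rpow_one, mul_one]; ring))
  have hsup : HasMaj (bHX ε) (cNormR R₀ H₀ (blkBK i bI) hG.lenle (-1)) (𝔬.G0 U₁ ∘ₗ Dds U₁ μ)
      (fun a a' => B₀ * Real.exp (-(δ₀ * (geo9K i).dist a a'))) :=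
    fun y' v hv y => ((hasMaj_of_in_zero hG1) y' v (hlocX y' v hv) y).trans
      (mul_le_mul_of_nonneg_left (hdomX y' v) (mul_nonneg hB₀ (Real.exp_nonneg _)))
  -- the gradient words at the sharp sup class are members into `𝔠⁽⁰⁾`
  have hgrad : ∀ ν : Fin (d + 1), HasMaj (bHX ε) (cNormR R₀ H₀ (blkBK i bI) hG.lenle 0)
      (coordOpK b (fun _ : Fin (d + 1) => cdBₗ i (cfg U₁) ν) ∘ₗ (𝔬.G0 U₁ ∘ₗ Dds U₁ μ))
      (fun a a' => Bi * Real.exp (-(δ₀ * (geo9K i).dist a a'))) := by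
    intro ν
    have h := h44 ν
    rw [hDd] at h
    intro y' v hv y
    have hb := h y' v hv y
    rw [cNormR_loc, Real.rpow_zero, one_mul]
    exact hb
  exact hasMaj_into_bHZKPG_of_sup_grad i b cfg U₁ hG hU hlev hβ1 hbI0 hcf w hw0 hw1 hB₀ hBi hδ₀ hsup hgrad

end Package

end

end Literature.MathematicalPhysics.QuantumFieldTheory.Balaban1983to89.B9HolderProbesKAFromGradSrc
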